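import Summits.ValiantsHypothesis.ValiantsHypothesis.Theses.RigidMinimalReps
import Summits.ValiantsHypothesis.ValiantsHypothesis.Theorems.RigidMinimalRepsTorusBound
import Summits.ValiantsHypothesis.ValiantsHypothesis.Theorems.RigidMinimalRepsMinimalRepTorusSymmetricCalibration

/-!
# Crux `MinimalRepTorusSymmetric` (stmt-ValiantsHypothesis-5112) — strategist r1 calibration:
# the symmetry-subgroup lattice of splits `X ⟺ NF_H ∧ LB_H`

Crux workfile (census evidence, `Cruxes/MinimalRepTorusSymmetric/CruxCalibrationR1.lean`), tree
theorems only.  Write `T n` for the crux's two-sided torus (generated by the substitutions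
`x_{kl} ↦ d_k e_l x_{kl}`, `d_k, e_l ≠ 0`) and, for ANY family of subgroups
`H n ≤ GL(Fin n × Fin n, ℂ)`,

* `NF H` ("normal form"): for all large `n` SOME optimal (size `dc(per_n)`) affine determinantal
  representation of `per_n` is `H n`-equivariant with exact lifts;
* `LB H` ("equivariant lower bound"): for all large `n` EVERY `H n`-equivariant representation of
  `per_n` has size `≥ 2ⁿ - 1`.

Then (this file):
* `crux_of_split`      : `NF H → LB H → X` for every `H` (no inclusion needed);
* `lb_of_crux`         : `X → LB H` for every `H` (the crux is the full lower bound eventually);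
* `nf_of_crux`         : `X → NF H` whenever `H n ≤ T n` eventually;
* `crux_iff_split`     : hence `X ↔ NF H ∧ LB H` for every eventually-sub-torus family `H` — every
  such split is LOSSLESS (a conjunct split of the crux), so its value is decided entirely by whether
  BOTH halves are separately attackable;
* the instance `H = leftTorus` (row scalings `x_{kl} ↦ d_k x_{kl}`): `LeftSym`, `LeftTorusBound(Eventually)`,
  `crux_iff_leftSplit`, and `leftTorusBoundEventually_of_leftTorusBound` (the uniform-from-`n = 3`
  analogue of the proved `TorusBound` implies the eventual half).

The census (`STRATEGY-CENSUS.md`, r1 § Decomposition) records why no member of this lattice has two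
plannable halves: for `H ⊇ T` the bound `LB H` is the tree theorem `torusBound_proof` and `NF H` is
`X` itself; for one-sided tori / large finite 2-groups `NF H` is toolless (its universal form is false
at `n = 3`, census s2 finding F1) while `LB H` is the exponential lower bound for general (unordered)
set-multilinear ABPs computing `per_n`, which implies super-polynomial set-multilinear-circuit and
non-commutative-circuit lower bounds for the permanent (Arvind–Raja 2016, §1; open since Nisan 1991);
for small finite groups and the scaling `𝔾_m`, symmetrisation is cheap, so `LB H` is already an
exponential homogeneous-ABP lower bound for `per_n`, i.e. summit-plus.
[cite: LandsbergRessayre2017, Thm. 2.8] [cite: Grenet2011, Thm. 1] [cite: arXiv:1511.02308, §1]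
-/

-- Sub = Summit single-conjunct layout: the duplicated namespace component is mandated by the tree.
set_option linter.dupNamespace false

noncomputable section

namespace Summit.ValiantsHypothesis.ValiantsHypothesis.Cruxes.MinimalRepTorusSymmetric.CensusR1

open Matrix MvPolynomial Finset
open Literature.Computability.AlgebraicComplexity
open Summit.ValiantsHypothesis.ValiantsHypothesis.Theses.RigidMinimalReps (MinimalRepTorusSymmetric)
open Summit.ValiantsHypothesis.ValiantsHypothesis.Theorems.RigidMinimalRepsMinimalRepTorusSymmetric
  (minimalRepTorusSymmetric_iff_grenetLowerEventually)

/-- The crux's two-sided torus `T n ≤ GL(Fin n × Fin n, ℂ)`: generated by the substitutions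
`x_{kl} ↦ d_k e_l x_{kl}` with all `d_k ≠ 0`, `e_l ≠ 0` (verbatim the subgroup in
`MinimalRepTorusSymmetric`). [cite: LandsbergRessayre2017, §6] -/
def twoSidedTorus (n : ℕ) : Subgroup (Matrix.GeneralLinearGroup (Fin n × Fin n) ℂ) :=
  Subgroup.closure {γ : Matrix.GeneralLinearGroup (Fin n × Fin n) ℂ | ∃ d e : Fin n → ℂ,
    (∀ i, d i ≠ 0) ∧ (∀ j, e j ≠ 0) ∧
    (γ : Matrix (Fin n × Fin n) (Fin n × Fin n) ℂ) = Matrix.diagonal (fun p => d p.1 * e p.2)}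

/-- The crux, restated over `twoSidedTorus` (definitionally the route decl). -/
theorem crux_def : MinimalRepTorusSymmetric ↔ ∃ n₀ : ℕ, ∀ n ≥ n₀,
    HasEquivariantDetRepr (twoSidedTorus n) (perPoly (Fin n) ℂ)
      (determinantalComplexity (perPoly (Fin n) ℂ)) := Iff.rfl

variable (H : ∀ n : ℕ, Subgroup (Matrix.GeneralLinearGroup (Fin n × Fin n) ℂ))

/-- `NF H`: for all large `n`, SOME optimal representation of `per_n` is `H n`-equivariant. -/
def NF : Prop :=
  ∃ n₀ : ℕ, ∀ n ≥ n₀, HasEquivariantDetRepr (H n) (perPoly (Fin n) ℂ)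
    (determinantalComplexity (perPoly (Fin n) ℂ))

/-- `LB H`: for all large `n`, EVERY `H n`-equivariant representation of `per_n` has size `≥ 2ⁿ - 1`. -/
def LB : Prop :=
  ∃ n₀ : ℕ, ∀ n ≥ n₀, ∀ (m : ℕ) (A : Matrix (Fin m) (Fin m) (MvPolynomial (Fin n × Fin n) ℂ)),
    IsEquivariantDetRepr (H n) (perPoly (Fin n) ℂ) A → 2 ^ n - 1 ≤ m

/-- **Every symmetry split closes the crux**: `NF H → LB H → X`, for ANY family `H` (an optimal
`H`-equivariant representation has size `dc(per_n) ≥ 2ⁿ - 1`, and the eventual Grenet lower bound is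
the crux by `minimalRepTorusSymmetric_iff_grenetLowerEventually`).
[cite: Grenet2011, Thm. 1] [cite: LandsbergRessayre2017, Thm. 2.8] -/
theorem crux_of_split (hNF : NF H) (hLB : LB H) : MinimalRepTorusSymmetric := by
  obtain ⟨n₁, h₁⟩ := hNF
  obtain ⟨n₂, h₂⟩ := hLB
  rw [minimalRepTorusSymmetric_iff_grenetLowerEventually]
  refine ⟨max n₁ n₂, fun n hn => ?_⟩
  obtain ⟨A, hA⟩ := h₁ n (le_trans (le_max_left _ _) hn)
  exact h₂ n (le_trans (le_max_right _ _) hn) _ A hA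

/-- **The crux gives every equivariant lower bound**: `X → LB H` for ANY `H` (it is the full
eventual lower bound `2ⁿ - 1 ≤ dc(per_n) ≤ m`). [cite: LandsbergRessayre2017, Thm. 2.8] -/
theorem lb_of_crux (h : MinimalRepTorusSymmetric) : LB H := by
  obtain ⟨n₀, h⟩ := minimalRepTorusSymmetric_iff_grenetLowerEventually.1 h
  refine ⟨n₀, fun n hn m A hA => le_trans (h n hn) ?_⟩
  exact determinantalComplexity_le_of_hasDetRepr ⟨A, hA.isAffineDetRepr⟩

/-- **The crux gives the normal form for every eventual sub-torus**: if `H n ≤ T n` for all large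
`n` then `X → NF H` (`HasEquivariantDetRepr.anti`). [cite: LandsbergRessayre2017, Def. 1.3] -/
theorem nf_of_crux (hH : ∃ n₁ : ℕ, ∀ n ≥ n₁, H n ≤ twoSidedTorus n) (h : MinimalRepTorusSymmetric) :
    NF H := by
  obtain ⟨n₀, h⟩ := h
  obtain ⟨n₁, hH⟩ := hH
  exact ⟨max n₀ n₁, fun n hn => (h n (le_trans (le_max_left _ _) hn)).anti
    (hH n (le_trans (le_max_right _ _) hn))⟩

/-- **The lattice of sub-torus splits is lossless**: for every eventual sub-torus family `H`,
`X ↔ NF H ∧ LB H`.  (So a split along `H` has content only if BOTH conjuncts are separately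
attackable; census r1 § Decomposition.) [cite: LandsbergRessayre2017, Thm. 2.8] -/
theorem crux_iff_split (hH : ∃ n₁ : ℕ, ∀ n ≥ n₁, H n ≤ twoSidedTorus n) :
    MinimalRepTorusSymmetric ↔ NF H ∧ LB H :=
  ⟨fun h => ⟨nf_of_crux H hH h, lb_of_crux H h⟩, fun h => crux_of_split H h.1 h.2⟩

/-! ## The instance analysed in r1: the LEFT (row) torus -/

/-- The left (row) torus: generated by `x_{kl} ↦ d_k x_{kl}`, all `d_k ≠ 0`.
[cite: LandsbergRessayre2017, §6 (left multiplication by T^{GL(E)})] -/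
def leftTorus (n : ℕ) : Subgroup (Matrix.GeneralLinearGroup (Fin n × Fin n) ℂ) :=
  Subgroup.closure {γ : Matrix.GeneralLinearGroup (Fin n × Fin n) ℂ | ∃ d : Fin n → ℂ,
    (∀ i, d i ≠ 0) ∧ (γ : Matrix (Fin n × Fin n) (Fin n × Fin n) ℂ) = Matrix.diagonal (fun p => d p.1)}

/-- `leftTorus n ≤ twoSidedTorus n` (take `e ≡ 1`). -/
theorem leftTorus_le_twoSidedTorus (n : ℕ) : leftTorus n ≤ twoSidedTorus n := by
  refine Subgroup.closure_mono ?_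
  rintro γ ⟨d, hd, hγ⟩
  exact ⟨d, fun _ => 1, hd, fun _ => one_ne_zero, by simpa using hγ⟩

/-- `LeftSym := NF leftTorus`: for all large `n` some optimal representation of `per_n` admits exact
lifts of every row scaling.  (Universal form FALSE at `n = 3`: census s2, finding F1.) -/
def LeftSym : Prop := NF leftTorus

/-- `LeftTorusBoundEventually := LB leftTorus`. -/
def LeftTorusBoundEventually : Prop := LB leftTorus

/-- `LeftTorusBound`: the uniform-from-`n = 3` analogue of the proved two-sided `TorusBound`
(`torusBound_proof`) with only ROW scalings lifted.  By the regular normal form (`Λ = 0 ⊕ 1`) and the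
grading by one generic lifted element this is the statement that general (unordered) set-multilinear
ABPs for `per_n` (parts = rows) have `≥ 2ⁿ` nodes — an open problem which implies non-commutative
circuit lower bounds for the permanent (Arvind–Raja 2016, §1).  NOT a tree theorem; NOT claimed.
[cite: arXiv:1511.02308, §1] [cite: LandsbergRessayre2017, Thm. 2.8] -/
def LeftTorusBound : Prop :=
  ∀ n : ℕ, 3 ≤ n → ∀ (m : ℕ) (A : Matrix (Fin m) (Fin m) (MvPolynomial (Fin n × Fin n) ℂ)),
    IsEquivariantDetRepr (leftTorus n) (perPoly (Fin n) ℂ) A → 2 ^ n - 1 ≤ m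

/-- The uniform bound implies the eventual one. -/
theorem leftTorusBoundEventually_of_leftTorusBound (h : LeftTorusBound) : LeftTorusBoundEventually :=
  ⟨3, fun n hn m A hA => h n hn m A hA⟩

/-- **The left split is a lossless conjunct split of the crux**: `X ↔ LeftSym ∧ LeftTorusBoundEventually`. -/
theorem crux_iff_leftSplit : MinimalRepTorusSymmetric ↔ LeftSym ∧ LeftTorusBoundEventually :=
  crux_iff_split leftTorus ⟨0, fun n _ => leftTorus_le_twoSidedTorus n⟩

/-- The typed split as it WOULD be filed (`route edit --split MinimalRepTorusSymmetric --into LeftSym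
LeftTorusBound --glue …`): `LeftSym → LeftTorusBound → X`.  Not filed: `LeftSym` has no mechanism
(universal form refuted at `n = 3`) and `LeftTorusBound` is the open unordered-smABP exponential lower
bound — neither half is plannable (census r1 § Decomposition). [cite: arXiv:1511.02308, §1] -/
theorem crux_of_leftSplit (h₁ : LeftSym) (h₂ : LeftTorusBound) : MinimalRepTorusSymmetric :=
  crux_of_split leftTorus h₁ (leftTorusBoundEventually_of_leftTorusBound h₂)

/-! ## The two extreme members, for the record -/

/-- `H = T` itself: `LB T` is the tree theorem (eventual form of `torusBound_proof`) … -/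
theorem lb_twoSidedTorus : LB twoSidedTorus :=
  ⟨3, fun n hn m A hA =>
    Summit.ValiantsHypothesis.ValiantsHypothesis.Theorems.RigidMinimalRepsTorusBound.torusBound_proof
      n hn m A hA⟩

/-- … so along `H = T` the split degenerates: `NF T ↔ X` (the normal-form half IS the crux). -/
theorem nf_twoSidedTorus_iff : NF twoSidedTorus ↔ MinimalRepTorusSymmetric :=
  ⟨fun h => crux_of_split twoSidedTorus h lb_twoSidedTorus,
    fun h => nf_of_crux twoSidedTorus ⟨0, fun _ _ => le_rfl⟩ h⟩

/-- `H = ⊥` (no symmetry): `NF ⊥` is a tree theorem (optimal representations exist) … -/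
theorem nf_bot : NF (fun _ => ⊥) :=
  ⟨0, fun n _ => hasEquivariantDetRepr_bot_iff.2
    (hasDetRepr_determinantalComplexity_holds (perPoly (Fin n) ℂ))⟩

/-- … so along `H = ⊥` the split degenerates the other way: `LB ⊥ ↔ X` (the lower-bound half IS
the crux = the eventual Grenet lower bound for ALL representations). -/
theorem lb_bot_iff : LB (fun _ => ⊥) ↔ MinimalRepTorusSymmetric :=
  ⟨fun h => crux_of_split _ nf_bot h, fun h => lb_of_crux _ h⟩

end Summit.ValiantsHypothesis.ValiantsHypothesis.Cruxes.MinimalRepTorusSymmetric.CensusR1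

end
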